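import Summits.CriticalPhenomena.CardyFormulaZ2.Theorems.CardyIKTransportIKMixedBoxCrossingXorDefs
import Summits.CriticalPhenomena.CardyFormulaZ2.Theorems.CardyIKTransportIKMixedBoxCrossingStubMirrorIndep
import Summits.CriticalPhenomena.CardyFormulaZ2.Theorems.CardyIKTransportIKLinearTransportStubConditionalRSWFlips
import Summits.CriticalPhenomena.CardyFormulaZ2.Theorems.CardyIKTransportIKLinearTransportStubCouplingToLimitsEvents

/-!
# Helper `indepFun_left_hIncr` toward the stub `stub_boundaryRobustFloor` (line `xor-rectangle-flip`,
# crux `IKMixedBoxCrossing`, stmt-CriticalPhenomena-5911)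

Support file (`--supports stmt-CriticalPhenomena-5911`): the COLUMN INNOVATIONS of the gauge colour field.
For every column pattern `S`, under the gauge law `μIK` the horizontal colour increments
`v ↦ 𝟙[v black] ⊕ 𝟙[v + e₁ black]` in the cell columns `v 0 ≥ 0` are independent of all the colours in the
cell columns `v 0 ≤ 0`:

  `IndepFun (ω ↦ {v | v 0 ≤ 0 ∧ v ∈ blackSet S ω}) (ω ↦ {v | 0 ≤ v 0 ∧ Xor (v ∈ blackSet S ω) (v + e₁ ∈ blackSet S ω)}) μIK`.

Proof (elementary, uniform in `S`). Write `ω = (A, B, Pb, Pf, C)` (column signs, row signs, biased / fair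
plaquettes, coins).
* LEFT reads `A` on `(-∞, 0]`, `B`, and the plaquettes of the faces `f` with `f 0 < 0` (the anchoring
  rectangle of a cell `v` with `v 0 ≤ 0` is `[v 0, 0) × …`): `left_congr`.
* INCREMENT: for `v 0 = x ≥ 0` the row sign `B (v 1)` cancels and the anchoring rectangles of `v` and
  `v + e₁` differ by the face column `x`, so the increment is `(A x ⊕ A (x+1)) ⊕` (parity of the face
  column `x` of the rectangle) (`xor_mem_blackSet_succ`); it reads `A` on `[0, ∞)` and the faces `f` with
  `f 0 ≥ 0`.
* The only shared bit is `A 0`. SHEAR: the map `A ↦ A ∆ (0, ∞)` if `0 ∈ A`, `A ↦ A` otherwise, preserves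
  the fair sign law (`IKQuarterTurn.measurePreserving_piecewise` with the flip invariance
  `crsw_sitePercolation_half_map_symmDiff`), fixes LEFT, and turns the increment at `x` into
  `(A' x ∧ 0 < x) ⊕ A' (x+1) ⊕ (face column x)` — a function of `A'` on `(0, ∞)` (`right_shear`).
* After the shear the two maps read DISJOINT coordinate sets of the five independent Bernoulli fields, hence
  are independent (`IndepRestrict.indepFun_inter_of_disjoint`, `indepFun_prod_pair` of the sibling line,
  `indepFun_projL_projR`); transfer back along the measure-preserving shear
  (`IndepRestrict.indepFun_map_of_comp`).
-/

noncomputable section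

namespace Summit.CriticalPhenomena.CardyFormulaZ2.Cruxes.IKMixedBoxCrossing.XorRectangleFlip

open scoped Classical symmDiff
open MeasureTheory ProbabilityTheory Set
open Literature.Probability.Percolation Literature.Probability.LatticeModels
open Summit.CriticalPhenomena.CardyFormulaZ2.Theorems.IKLinearTransport.PinnedDiagramExchange (Ω μIK blackSet parSet
  crsw_measurable_symmDiff_right crsw_sitePercolation_half_map_symmDiff crsw_mem_blackSet_rowFlip)
open Summit.CriticalPhenomena.CardyFormulaZ2.Theorems.IKLinearTransport.PinnedDiagramExchange.CouplingToLimits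
  (measurable_xor measurable_mem_blackSet measurable_mem_parSet measurable_card_filter)
open Summit.CriticalPhenomena.CardyFormulaZ2.Theorems.IKQuarterTurn (measurePreserving_piecewise mem_Ico_min_max)
open Summit.CriticalPhenomena.CardyFormulaZ2.Cruxes.IKMixedBoxCrossing.PairedMirrorExploration.IndepRestrict
  (indepFun_map_of_comp indepFun_inter_of_disjoint indepFun_prod_pair)
open Summit.CriticalPhenomena.CardyFormulaZ2.Cruxes.IKMixedBoxCrossing.PairedMirrorExploration.MirrorRP
  renaming measurable_inter_const → mInter

namespace IncrStub

/-! ## §1 The shear of the column signs -/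

/-- The column-sign shear (`A ↦ A ∆ (0, ∞)` if `0 ∈ A`, `A ↦ A` otherwise) preserves the fair sign law. -/
theorem measurePreserving_shear :
    MeasurePreserving (fun A : Set ℤ => {x : ℤ | Xor (x ∈ A) ((0 : ℤ) ∈ A ∧ 0 < x)})
      (sitePercolation ℤ half) (sitePercolation ℤ half) := by
  have hE : MeasurableSet {A : Set ℤ | (0 : ℤ) ∈ A} := measurableSet_setOf.2 (measurable_set_mem 0)
  have hκ : MeasurePreserving (fun A : Set ℤ => A ∆ Set.Ioi (0 : ℤ)) (sitePercolation ℤ half)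
      (sitePercolation ℤ half) :=
    ⟨crsw_measurable_symmDiff_right _, crsw_sitePercolation_half_map_symmDiff _⟩
  have hinv : (fun A : Set ℤ => A ∆ Set.Ioi (0 : ℤ)) ⁻¹' {A : Set ℤ | (0 : ℤ) ∈ A} = {A | (0 : ℤ) ∈ A} := by
    ext A
    simp only [Set.mem_preimage, Set.mem_setOf_eq, Set.mem_symmDiff, Set.mem_Ioi, lt_self_iff_false,
      not_false_eq_true, and_true, false_and, or_false]
  have h := measurePreserving_piecewise hκ hE hinv
  have hfun : (fun A : Set ℤ => {x : ℤ | Xor (x ∈ A) ((0 : ℤ) ∈ A ∧ 0 < x)}) =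
      {A : Set ℤ | (0 : ℤ) ∈ A}.piecewise (fun A : Set ℤ => A ∆ Set.Ioi (0 : ℤ)) id := by
    funext A
    by_cases hA : (0 : ℤ) ∈ A
    · rw [Set.piecewise_eq_of_mem _ _ _ (show A ∈ {B : Set ℤ | (0 : ℤ) ∈ B} from hA)]
      ext x
      simp only [Set.mem_setOf_eq, Set.mem_symmDiff, Set.mem_Ioi, hA, true_and, xor_def]
    · rw [Set.piecewise_eq_of_notMem _ _ _ (show A ∉ {B : Set ℤ | (0 : ℤ) ∈ B} from hA)]
      ext x
      simp only [Set.mem_setOf_eq, id_eq, hA, false_and, xor_def, not_false_eq_true, and_true, or_false]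
  rw [hfun]
  exact h

/-- The shear acting on the first gauge coordinate preserves `μIK`. -/
theorem measurePreserving_shearΩ :
    MeasurePreserving (fun ω : Ω => (({x : ℤ | Xor (x ∈ ω.1) ((0 : ℤ) ∈ ω.1 ∧ 0 < x)}, ω.2) : Ω)) μIK μIK := by
  unfold μIK
  exact measurePreserving_shear.prod (MeasurePreserving.id _)

/-- The sheared column signs are the old ones flipped on `{x | 0 ∈ A ∧ 0 < x}`. -/
theorem shear_eq_symmDiff (A : Set ℤ) :
    {x : ℤ | Xor (x ∈ A) ((0 : ℤ) ∈ A ∧ 0 < x)} = A ∆ {x : ℤ | (0 : ℤ) ∈ A ∧ 0 < x} := by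
  ext x
  simp only [Set.mem_setOf_eq, Set.mem_symmDiff, xor_def]

/-- Colours after the shear: the cell `v` is toggled iff `0 ∈ A ∧ 0 < v 0`. -/
theorem mem_blackSet_shear (S : Set ℤ) (ω : Ω) (v : Site 2) :
    v ∈ blackSet S ((({x : ℤ | Xor (x ∈ ω.1) ((0 : ℤ) ∈ ω.1 ∧ 0 < x)}, ω.2) : Ω)) ↔
      Xor (v ∈ blackSet S ω) ((0 : ℤ) ∈ ω.1 ∧ 0 < v 0) := by
  rw [shear_eq_symmDiff]
  exact crsw_mem_blackSet_rowFlip S _ ω v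

/-! ## §2 The horizontal increment of the colour -/

/-- For `x ≥ 0` the anchoring rectangle to column `x + 1` is that to column `x` plus the face column `x`. -/
theorem card_filter_rect_succ (P : ℤ × ℤ → Prop) [DecidablePred P] (x : ℤ) (hx : 0 ≤ x) (J : Finset ℤ) :
    ((Finset.Ico (min 0 (x + 1)) (max 0 (x + 1)) ×ˢ J).filter P).card =
      ((Finset.Ico (min 0 x) (max 0 x) ×ˢ J).filter P).card + ((({x} : Finset ℤ) ×ˢ J).filter P).card := by
  have h1 : min 0 (x + 1) = 0 := min_eq_left (by omega)
  have h2 : max 0 (x + 1) = x + 1 := max_eq_right (by omega)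
  rw [h1, h2, min_eq_left hx, max_eq_right hx, ← Finset.insert_Ico_right_eq_Ico_add_one hx,
    Finset.insert_eq, Finset.union_comm, Finset.union_product, Finset.filter_union,
    Finset.card_union_of_disjoint]
  exact Finset.disjoint_filter_filter
    (Finset.disjoint_product.2 (Or.inl (Finset.disjoint_singleton_right.2 Finset.right_notMem_Ico)))

/-- Exclusive-or bookkeeping for the increment (the row sign `b` cancels). -/
theorem xor_incr_aux (a₀ a₁ b p q : Prop) :
    (Xor (Xor a₀ (Xor b p)) (Xor a₁ (Xor b (p ↔ ¬q))) ↔ Xor (Xor a₀ a₁) q) := by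
  grind

/-- THE INCREMENT: for `v 0 ≥ 0`, `𝟙[v black] ⊕ 𝟙[v + e₁ black] = (A (v 0) ⊕ A (v 0 + 1)) ⊕` (parity of the
plaquettes of the face column `v 0` of the anchoring rectangle); the row sign cancels. -/
theorem xor_mem_blackSet_succ (S : Set ℤ) (ω : Ω) (v : Site 2) (hv : 0 ≤ v 0) :
    (Xor (v ∈ blackSet S ω) (v + ![1, 0] ∈ blackSet S ω) ↔
      Xor (Xor (v 0 ∈ ω.1) (v 0 + 1 ∈ ω.1))
        (Odd ((({v 0} : Finset ℤ) ×ˢ Finset.Ico (min 0 (v 1)) (max 0 (v 1))).filter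
          (fun f : ℤ × ℤ => (![f.1, f.2] : Site 2) ∈ parSet S ω)).card)) := by
  have h0 : (v + ![1, 0] : Site 2) 0 = v 0 + 1 := by simp
  have h1 : (v + ![1, 0] : Site 2) 1 = v 1 := by simp
  simp only [blackSet, Set.mem_setOf_eq, h0, h1]
  rw [card_filter_rect_succ _ _ hv, Nat.odd_add, ← Nat.not_odd_iff_even]
  exact xor_incr_aux _ _ _ _ _

/-- Exclusive-or bookkeeping for the shear. -/
theorem xor_shear_aux (c c' t t' : Prop) : (Xor (Xor c t) (Xor c' t') ↔ Xor (Xor c c') (Xor t t')) := by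
  grind

/-- After the shear, the increment at `v 0 = x ≥ 0` reads `(A x ∧ 0 < x) ⊕ A (x + 1)` and the face column `x`. -/
theorem xor_mem_blackSet_succ_shear (S : Set ℤ) (ω : Ω) (v : Site 2) (hv : 0 ≤ v 0) :
    (Xor (v ∈ blackSet S ((({x : ℤ | Xor (x ∈ ω.1) ((0 : ℤ) ∈ ω.1 ∧ 0 < x)}, ω.2) : Ω)))
        (v + ![1, 0] ∈ blackSet S ((({x : ℤ | Xor (x ∈ ω.1) ((0 : ℤ) ∈ ω.1 ∧ 0 < x)}, ω.2) : Ω))) ↔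
      Xor (Xor (v 0 ∈ ω.1 ∩ Set.Ioi 0) (v 0 + 1 ∈ ω.1 ∩ Set.Ioi 0))
        (Odd ((({v 0} : Finset ℤ) ×ˢ Finset.Ico (min 0 (v 1)) (max 0 (v 1))).filter
          (fun f : ℤ × ℤ => (![f.1, f.2] : Site 2) ∈ parSet S ω)).card)) := by
  have h0 : (v + ![1, 0] : Site 2) 0 = v 0 + 1 := by simp
  rw [mem_blackSet_shear, mem_blackSet_shear, h0, xor_shear_aux, xor_mem_blackSet_succ S ω v hv]
  simp only [Set.mem_inter_iff, Set.mem_Ioi]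
  have hx1 : 0 < v 0 + 1 := by omega
  by_cases hx : 0 < v 0
  · simp only [hx, hx1, and_true]
    grind
  · have hx0 : v 0 = 0 := by omega
    simp only [hx0, lt_self_iff_false, and_false, zero_add, zero_lt_one, and_true]
    grind

/-! ## §3 What the two maps read -/

/-- Locality of the plaquette-parity set: membership of `f` reads the two plaquette bits at `f` only. -/
theorem mem_parSet_congr (S : Set ℤ) {ω ω' : Ω} {f : Site 2} (h₁ : (f ∈ ω'.2.2.1 ↔ f ∈ ω.2.2.1))
    (h₂ : (f ∈ ω'.2.2.2.1 ↔ f ∈ ω.2.2.2.1)) : (f ∈ parSet S ω' ↔ f ∈ parSet S ω) := by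
  simp only [parSet, Set.mem_setOf_eq, h₁, h₂]

/-- Locality of the colour: `v ∈ blackSet S ω` reads `A (v 0)`, `B (v 1)` and the parity set on the columns of
the anchoring rectangle of `v`. -/
theorem mem_blackSet_congr (S : Set ℤ) {ω ω' : Ω} {v : Site 2} (hA : (v 0 ∈ ω'.1 ↔ v 0 ∈ ω.1))
    (hB : (v 1 ∈ ω'.2.1 ↔ v 1 ∈ ω.2.1))
    (hP : ∀ f : ℤ × ℤ, f.1 ∈ Finset.Ico (min 0 (v 0)) (max 0 (v 0)) →
      ((![f.1, f.2] : Site 2) ∈ parSet S ω' ↔ (![f.1, f.2] : Site 2) ∈ parSet S ω)) :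
    (v ∈ blackSet S ω' ↔ v ∈ blackSet S ω) := by
  simp only [blackSet, Set.mem_setOf_eq, hA, hB]
  rw [Finset.filter_congr (fun f hf => hP f (Finset.mem_product.1 hf).1)]

/-- LEFT reads only `A` on `(-∞, 0]`, `B`, and the plaquettes of the faces `f` with `f 0 < 0`. -/
theorem left_congr (S : Set ℤ) {ω ω' : Ω} (hA : ∀ y : ℤ, y ≤ 0 → (y ∈ ω'.1 ↔ y ∈ ω.1))
    (hB : ∀ y : ℤ, (y ∈ ω'.2.1 ↔ y ∈ ω.2.1)) (hP : ∀ f : Site 2, f 0 < 0 → (f ∈ parSet S ω' ↔ f ∈ parSet S ω)) :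
    {v : Site 2 | v 0 ≤ 0 ∧ v ∈ blackSet S ω'} = {v : Site 2 | v 0 ≤ 0 ∧ v ∈ blackSet S ω} := by
  ext v
  simp only [Set.mem_setOf_eq]
  refine and_congr_right fun hv => mem_blackSet_congr S (hA _ hv) (hB _) fun f hf => hP _ ?_
  have hf' : f.1 < 0 := by rw [mem_Ico_min_max] at hf; omega
  simpa using hf'

/-- The sheared INCREMENT reads only `A ∩ (0, ∞)` and the plaquettes of the faces `f` with `f 0 ≥ 0`. -/
theorem rightShear_congr (S : Set ℤ) {ω ω' : Ω} (hA : ∀ y : ℤ, (y ∈ ω'.1 ∩ Set.Ioi 0 ↔ y ∈ ω.1 ∩ Set.Ioi 0))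
    (hP : ∀ f : Site 2, 0 ≤ f 0 → (f ∈ parSet S ω' ↔ f ∈ parSet S ω)) :
    {v : Site 2 | 0 ≤ v 0 ∧ Xor (Xor (v 0 ∈ ω'.1 ∩ Set.Ioi 0) (v 0 + 1 ∈ ω'.1 ∩ Set.Ioi 0))
        (Odd ((({v 0} : Finset ℤ) ×ˢ Finset.Ico (min 0 (v 1)) (max 0 (v 1))).filter
          (fun f : ℤ × ℤ => (![f.1, f.2] : Site 2) ∈ parSet S ω')).card)} =
      {v : Site 2 | 0 ≤ v 0 ∧ Xor (Xor (v 0 ∈ ω.1 ∩ Set.Ioi 0) (v 0 + 1 ∈ ω.1 ∩ Set.Ioi 0))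
        (Odd ((({v 0} : Finset ℤ) ×ˢ Finset.Ico (min 0 (v 1)) (max 0 (v 1))).filter
          (fun f : ℤ × ℤ => (![f.1, f.2] : Site 2) ∈ parSet S ω)).card)} := by
  ext v
  simp only [Set.mem_setOf_eq, hA]
  refine and_congr_right fun hv => ?_
  have hfilter : ∀ f ∈ ({v 0} : Finset ℤ) ×ˢ Finset.Ico (min 0 (v 1)) (max 0 (v 1)),
      ((![f.1, f.2] : Site 2) ∈ parSet S ω' ↔ (![f.1, f.2] : Site 2) ∈ parSet S ω) := by
    intro f hf
    have hf' : f.1 = v 0 := by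
      rw [Finset.mem_product, Finset.mem_singleton] at hf
      exact hf.1
    refine hP _ ?_
    simpa [hf'] using hv
  rw [Finset.filter_congr hfilter]

/-- LEFT after restriction to its coordinates. -/
theorem left_projL (S : Set ℤ) (ω : Ω) :
    (fun ω : Ω => {v : Site 2 | v 0 ≤ 0 ∧ v ∈ blackSet S ω})
        ((ω.1 ∩ Set.Iic 0, (ω.2.1 ∩ Set.univ, (ω.2.2.1 ∩ {f : Site 2 | f 0 < 0},
          (ω.2.2.2.1 ∩ {f : Site 2 | f 0 < 0}, ω.2.2.2.2 ∩ (∅ : Set (Site 2)))))) : Ω) =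
      {v : Site 2 | v 0 ≤ 0 ∧ v ∈ blackSet S ω} :=
  left_congr S (fun _ hy => ⟨fun h => h.1, fun h => ⟨h, hy⟩⟩) (fun _ => ⟨fun h => h.1, fun h => ⟨h, trivial⟩⟩)
    fun _ hf => mem_parSet_congr S ⟨fun h => h.1, fun h => ⟨h, hf⟩⟩ ⟨fun h => h.1, fun h => ⟨h, hf⟩⟩

/-- LEFT is unchanged by the shear (it reads `A` on `(-∞, 0]` only). -/
theorem left_shear (S : Set ℤ) (ω : Ω) :
    (fun ω : Ω => {v : Site 2 | v 0 ≤ 0 ∧ v ∈ blackSet S ω})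
        (({x : ℤ | Xor (x ∈ ω.1) ((0 : ℤ) ∈ ω.1 ∧ 0 < x)}, ω.2) : Ω) =
      {v : Site 2 | v 0 ≤ 0 ∧ v ∈ blackSet S ω} := by
  refine left_congr S (fun y hy => ?_) (fun _ => Iff.rfl) (fun _ _ => Iff.rfl)
  have h' : ¬ ((0 : ℤ) ∈ ω.1 ∧ 0 < y) := fun h => by omega
  show (Xor (y ∈ ω.1) ((0 : ℤ) ∈ ω.1 ∧ 0 < y) ↔ y ∈ ω.1)
  simp only [xor_def, h', not_false_eq_true, and_true, false_and, or_false]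

/-- The sheared INCREMENT after restriction to its coordinates. -/
theorem right_projR (S : Set ℤ) (ω : Ω) :
    (fun ω : Ω => {v : Site 2 | 0 ≤ v 0 ∧ Xor (Xor (v 0 ∈ ω.1 ∩ Set.Ioi 0) (v 0 + 1 ∈ ω.1 ∩ Set.Ioi 0))
        (Odd ((({v 0} : Finset ℤ) ×ˢ Finset.Ico (min 0 (v 1)) (max 0 (v 1))).filter
          (fun f : ℤ × ℤ => (![f.1, f.2] : Site 2) ∈ parSet S ω)).card)})
        ((ω.1 ∩ Set.Ioi 0, (ω.2.1 ∩ (∅ : Set ℤ), (ω.2.2.1 ∩ {f : Site 2 | 0 ≤ f 0},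
          (ω.2.2.2.1 ∩ {f : Site 2 | 0 ≤ f 0}, ω.2.2.2.2 ∩ (∅ : Set (Site 2)))))) : Ω) =
      {v : Site 2 | 0 ≤ v 0 ∧ Xor (Xor (v 0 ∈ ω.1 ∩ Set.Ioi 0) (v 0 + 1 ∈ ω.1 ∩ Set.Ioi 0))
        (Odd ((({v 0} : Finset ℤ) ×ˢ Finset.Ico (min 0 (v 1)) (max 0 (v 1))).filter
          (fun f : ℤ × ℤ => (![f.1, f.2] : Site 2) ∈ parSet S ω)).card)} :=
  rightShear_congr S (fun _ => ⟨fun h => ⟨h.1.1, h.2⟩, fun h => ⟨⟨h.1, h.2⟩, h.2⟩⟩)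
    fun _ hf => mem_parSet_congr S ⟨fun h => h.1, fun h => ⟨h, hf⟩⟩ ⟨fun h => h.1, fun h => ⟨h, hf⟩⟩

/-- The INCREMENT map after the shear is the sheared INCREMENT. -/
theorem right_shear (S : Set ℤ) (ω : Ω) :
    (fun ω : Ω => {v : Site 2 | 0 ≤ v 0 ∧ Xor (v ∈ blackSet S ω) (v + ![1, 0] ∈ blackSet S ω)})
        (({x : ℤ | Xor (x ∈ ω.1) ((0 : ℤ) ∈ ω.1 ∧ 0 < x)}, ω.2) : Ω) =
      {v : Site 2 | 0 ≤ v 0 ∧ Xor (Xor (v 0 ∈ ω.1 ∩ Set.Ioi 0) (v 0 + 1 ∈ ω.1 ∩ Set.Ioi 0))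
        (Odd ((({v 0} : Finset ℤ) ×ˢ Finset.Ico (min 0 (v 1)) (max 0 (v 1))).filter
          (fun f : ℤ × ℤ => (![f.1, f.2] : Site 2) ∈ parSet S ω)).card)} := by
  ext v
  simp only [Set.mem_setOf_eq]
  exact and_congr_right fun hv => xor_mem_blackSet_succ_shear S ω v hv

/-! ## §4 Measurability -/

/-- LEFT is measurable. -/
theorem measurable_left (S : Set ℤ) : Measurable fun ω : Ω => {v : Site 2 | v 0 ≤ 0 ∧ v ∈ blackSet S ω} :=
  measurable_set_iff.2 fun v => measurable_const.and (measurable_mem_blackSet S v)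

/-- The INCREMENT map is measurable. -/
theorem measurable_right (S : Set ℤ) :
    Measurable fun ω : Ω => {v : Site 2 | 0 ≤ v 0 ∧ Xor (v ∈ blackSet S ω) (v + ![1, 0] ∈ blackSet S ω)} :=
  measurable_set_iff.2 fun v =>
    measurable_const.and (measurable_xor (measurable_mem_blackSet S v) (measurable_mem_blackSet S _))

/-- The sheared INCREMENT map is measurable. -/
theorem measurable_rightShear (S : Set ℤ) :
    Measurable fun ω : Ω => {v : Site 2 | 0 ≤ v 0 ∧ Xor (Xor (v 0 ∈ ω.1 ∩ Set.Ioi 0) (v 0 + 1 ∈ ω.1 ∩ Set.Ioi 0))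
        (Odd ((({v 0} : Finset ℤ) ×ˢ Finset.Ico (min 0 (v 1)) (max 0 (v 1))).filter
          (fun f : ℤ × ℤ => (![f.1, f.2] : Site 2) ∈ parSet S ω)).card)} := by
  refine measurable_set_iff.2 fun v => measurable_const.and (measurable_xor (measurable_xor ?_ ?_) ?_)
  · exact (measurable_set_mem (v 0)).comp ((mInter _).comp measurable_fst)
  · exact (measurable_set_mem (v 0 + 1)).comp ((mInter _).comp measurable_fst)
  · exact (measurable_of_countable fun n : ℕ => Odd n).comp
      (measurable_card_filter _ fun f => measurable_mem_parSet S _)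

/-! ## §5 Independence -/

/-- Disjoint coordinate restrictions of the five gauge fields are independent under `μIK`. -/
theorem indepFun_projL_projR :
    IndepFun (fun ω : Ω => ((ω.1 ∩ Set.Iic 0, (ω.2.1 ∩ Set.univ, (ω.2.2.1 ∩ {f : Site 2 | f 0 < 0},
        (ω.2.2.2.1 ∩ {f : Site 2 | f 0 < 0}, ω.2.2.2.2 ∩ (∅ : Set (Site 2)))))) : Ω))
      (fun ω : Ω => ((ω.1 ∩ Set.Ioi 0, (ω.2.1 ∩ (∅ : Set ℤ), (ω.2.2.1 ∩ {f : Site 2 | 0 ≤ f 0},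
        (ω.2.2.2.1 ∩ {f : Site 2 | 0 ≤ f 0}, ω.2.2.2.2 ∩ (∅ : Set (Site 2)))))) : Ω)) μIK := by
  have dA : Disjoint (Set.Iic (0 : ℤ)) (Set.Ioi 0) :=
    Set.disjoint_left.2 fun x (hx : x ≤ 0) (hx' : 0 < x) => by omega
  have dB : Disjoint (Set.univ : Set ℤ) ∅ := disjoint_bot_right
  have dF : Disjoint {f : Site 2 | f 0 < 0} {f : Site 2 | 0 ≤ f 0} :=
    Set.disjoint_left.2 fun f (hf : f 0 < 0) (hf' : 0 ≤ f 0) => by omega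
  have dC : Disjoint (∅ : Set (Site 2)) ∅ := disjoint_bot_left
  have h45 := indepFun_prod_pair (mInter {f : Site 2 | f 0 < 0}) (mInter {f : Site 2 | 0 ≤ f 0})
    (mInter (∅ : Set (Site 2))) (mInter (∅ : Set (Site 2)))
    (indepFun_inter_of_disjoint half dF) (indepFun_inter_of_disjoint half dC)
  have h345 := indepFun_prod_pair (mInter {f : Site 2 | f 0 < 0}) (mInter {f : Site 2 | 0 ≤ f 0})
    (((mInter {f : Site 2 | f 0 < 0}).comp measurable_fst).prodMk ((mInter (∅ : Set (Site 2))).comp measurable_snd) :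
      Measurable fun x : Set (Site 2) × Set (Site 2) => (x.1 ∩ {f : Site 2 | f 0 < 0}, x.2 ∩ (∅ : Set (Site 2))))
    (((mInter {f : Site 2 | 0 ≤ f 0}).comp measurable_fst).prodMk ((mInter (∅ : Set (Site 2))).comp measurable_snd) :
      Measurable fun x : Set (Site 2) × Set (Site 2) => (x.1 ∩ {f : Site 2 | 0 ≤ f 0}, x.2 ∩ (∅ : Set (Site 2))))
    (indepFun_inter_of_disjoint (Set.projIcc (0:ℝ) 1 zero_le_one (2 * Real.sqrt 3 - 3)) dF) h45
  have h2345 := indepFun_prod_pair (mInter (Set.univ : Set ℤ)) (mInter (∅ : Set ℤ))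
    (((mInter {f : Site 2 | f 0 < 0}).comp measurable_fst).prodMk
      ((((mInter {f : Site 2 | f 0 < 0}).comp measurable_fst).prodMk
        ((mInter (∅ : Set (Site 2))).comp measurable_snd)).comp measurable_snd) :
      Measurable fun x : Set (Site 2) × (Set (Site 2) × Set (Site 2)) =>
        (x.1 ∩ {f : Site 2 | f 0 < 0}, (x.2.1 ∩ {f : Site 2 | f 0 < 0}, x.2.2 ∩ (∅ : Set (Site 2)))))
    (((mInter {f : Site 2 | 0 ≤ f 0}).comp measurable_fst).prodMk
      ((((mInter {f : Site 2 | 0 ≤ f 0}).comp measurable_fst).prodMk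
        ((mInter (∅ : Set (Site 2))).comp measurable_snd)).comp measurable_snd) :
      Measurable fun x : Set (Site 2) × (Set (Site 2) × Set (Site 2)) =>
        (x.1 ∩ {f : Site 2 | 0 ≤ f 0}, (x.2.1 ∩ {f : Site 2 | 0 ≤ f 0}, x.2.2 ∩ (∅ : Set (Site 2)))))
    (indepFun_inter_of_disjoint half dB) h345
  have h := indepFun_prod_pair (mInter (Set.Iic (0 : ℤ))) (mInter (Set.Ioi (0 : ℤ)))
    (((mInter (Set.univ : Set ℤ)).comp measurable_fst).prodMk
      ((((mInter {f : Site 2 | f 0 < 0}).comp measurable_fst).prodMk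
        ((((mInter {f : Site 2 | f 0 < 0}).comp measurable_fst).prodMk
          ((mInter (∅ : Set (Site 2))).comp measurable_snd)).comp measurable_snd)).comp measurable_snd) :
      Measurable fun x : Set ℤ × (Set (Site 2) × (Set (Site 2) × Set (Site 2))) =>
        (x.1 ∩ Set.univ, (x.2.1 ∩ {f : Site 2 | f 0 < 0}, (x.2.2.1 ∩ {f : Site 2 | f 0 < 0},
          x.2.2.2 ∩ (∅ : Set (Site 2))))))
    (((mInter (∅ : Set ℤ)).comp measurable_fst).prodMk
      ((((mInter {f : Site 2 | 0 ≤ f 0}).comp measurable_fst).prodMk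
        ((((mInter {f : Site 2 | 0 ≤ f 0}).comp measurable_fst).prodMk
          ((mInter (∅ : Set (Site 2))).comp measurable_snd)).comp measurable_snd)).comp measurable_snd) :
      Measurable fun x : Set ℤ × (Set (Site 2) × (Set (Site 2) × Set (Site 2))) =>
        (x.1 ∩ ∅, (x.2.1 ∩ {f : Site 2 | 0 ≤ f 0}, (x.2.2.1 ∩ {f : Site 2 | 0 ≤ f 0},
          x.2.2.2 ∩ (∅ : Set (Site 2))))))
    (indepFun_inter_of_disjoint half dA) h2345
  unfold μIK
  exact h

/-- LEFT and the sheared INCREMENT are independent under `μIK` (they read disjoint coordinate sets). -/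
theorem indepFun_left_rightShear (S : Set ℤ) :
    IndepFun (fun ω : Ω => {v : Site 2 | v 0 ≤ 0 ∧ v ∈ blackSet S ω})
      (fun ω : Ω => {v : Site 2 | 0 ≤ v 0 ∧ Xor (Xor (v 0 ∈ ω.1 ∩ Set.Ioi 0) (v 0 + 1 ∈ ω.1 ∩ Set.Ioi 0))
        (Odd ((({v 0} : Finset ℤ) ×ˢ Finset.Ico (min 0 (v 1)) (max 0 (v 1))).filter
          (fun f : ℤ × ℤ => (![f.1, f.2] : Site 2) ∈ parSet S ω)).card)}) μIK :=
  (indepFun_projL_projR.comp (measurable_left S) (measurable_rightShear S)).congr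
    (ae_of_all _ fun ω => left_projL S ω) (ae_of_all _ fun ω => right_projR S ω)

/-- LEFT and INCREMENT, both precomposed with the shear, are independent under `μIK`. -/
theorem indepFun_left_right_comp_shear (S : Set ℤ) :
    IndepFun ((fun ω : Ω => {v : Site 2 | v 0 ≤ 0 ∧ v ∈ blackSet S ω}) ∘
        (fun ω : Ω => (({x : ℤ | Xor (x ∈ ω.1) ((0 : ℤ) ∈ ω.1 ∧ 0 < x)}, ω.2) : Ω)))
      ((fun ω : Ω => {v : Site 2 | 0 ≤ v 0 ∧ Xor (v ∈ blackSet S ω) (v + ![1, 0] ∈ blackSet S ω)}) ∘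
        (fun ω : Ω => (({x : ℤ | Xor (x ∈ ω.1) ((0 : ℤ) ∈ ω.1 ∧ 0 < x)}, ω.2) : Ω))) μIK :=
  (indepFun_left_rightShear S).congr (ae_of_all _ fun ω => (left_shear S ω).symm)
    (ae_of_all _ fun ω => (right_shear S ω).symm)

end IncrStub

open IncrStub in
/-- **Registered helper `indepFun_left_hIncr`** (toward `stub_boundaryRobustFloor`): for every column pattern
`S`, under the gauge law `μIK` the horizontal colour increments in the cell columns `≥ 0` are independent of
all the colours in the cell columns `≤ 0` (the column innovations of the gauge). -/
theorem indepFun_left_hIncr : ∀ S : Set ℤ, ProbabilityTheory.IndepFun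
    (fun ω : Ω => {v : Site 2 | v 0 ≤ 0 ∧ v ∈ blackSet S ω})
    (fun ω : Ω => {v : Site 2 | 0 ≤ v 0 ∧ Xor (v ∈ blackSet S ω) (v + ![1, 0] ∈ blackSet S ω)}) μIK := by
  intro S
  have h := indepFun_map_of_comp measurePreserving_shearΩ.measurable (measurable_left S) (measurable_right S)
    (indepFun_left_right_comp_shear S)
  rwa [measurePreserving_shearΩ.map_eq] at h

end Summit.CriticalPhenomena.CardyFormulaZ2.Cruxes.IKMixedBoxCrossing.XorRectangleFlip

end
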